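import Summits.NavierStokesRegularity.NavierStokesRegularity.Theses.SymmetryModuliCount
import Literature.Analysis.FluidPDE.TypeIAncientMild
import Literature.Analysis.FluidPDE.KatoSymmetryCovariance
import Literature.Analysis.FluidPDE.KNSSOseenMildDecayTools
import Literature.Analysis.FluidPDE.KNSSTypeIRateLiouvilleHolds
-- landed Negative lemmas of this crux (p73328, p73829, LoadBearing): imported so that the scratch check sees
-- them next to the stubs — every stub below keeps the FULL class `IsTypeIAncientMild C u` (Type-I decay AND the
-- Oseen identity back to `t = -∞`, on the whole past or on a backward END), so none is an instance of a refuted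
-- mutant (`…_false_without_typeI / _without_mild / _with_bounded / _typeI_near_zero_bounded_past /
-- _mild_on_window / _on_window`).
import Summits.NavierStokesRegularity.NavierStokesRegularity.Theorems.SymmetricLiouville.Negative.LoadBearing
import HarnessLib.Audit

/-!
# Skeleton line `screw-lattice-blowdown` for crux `SymmetricLiouville` (stmt-NavierStokesRegularity-4053)

Route `SymmetryModuliCount`, sub-problem `NavierStokesRegularity` (Clay A, positive side).  Crux-plan skeleton
(planner `cruxplan-stmt-NavierStokesRegularity-4053-screw-lattice-blowdown`, round 1) of the crux idea card
`Cruxes/SymmetricLiouville/Ideas/screw-lattice-blowdown.md` (ideator 3; first lemmas `Ideator3Sketch.lean`),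
with the panel notes `TRIAGE-r1-{1,2,3}.md` (pass ×3; merge group "lattice in the screw + period-shrinking
blow-down + 2.5-D tree leaf + ε-Liouville at −∞" = cards `screw-lattice-blowdown` ≈ `blowdown-kills-pitch` ≈
`degenerate-stabiliser-zoom` §(H); panel instruction acted on: "keep ONE line: first lemma
`PeriodicTypeIAncientLiouville`, bridge `periodic_of_screw`", with the ONE unproved analytic input of every zoom
card — F3, sequential compactness + mild closure of `A_C` — named as its own stub).

## The crux, its leaves, and what this line does

`SymmetricLiouville`: every `u` in the Type-I KNSS-mild ancient class `A_C` (`IsTypeIAncientMild C u`; the decl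
spells the four clauses out, `isTypeIAncientMild_iff` is the definitional bridge) annihilated by the generator
`L_ξ u = ∇u·(a + σx + Ax) + σu + 2σt ∂_t u − Au` of a nonzero `ξ = (a, σ, A) ∈ sim(3)` (`A` skew) vanishes.
Conjugacy leaves (normal forms, TRIAGE-r1-1 S8): `σ = 0`, `a ∉ range A` (translation / screw of NONZERO
pitch); `σ = 0`, `a ∈ range A`, `A ≠ 0` (rotation about a shifted axis, swirl allowed); `σ ≠ 0` (spiral scaling
about a centre).  THIS LINE closes the first leaf — listed OPEN in the crux's why-might-fail ("only STEADY
helical Liouville is in print, HanWangXie2025") — and cuts it along the card's lever into four genuine stubs: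

1. `stub_screwLattice` (S–M; the card's `periodic_of_screw`, = the statement `HelicalOrTranslationIsPeriodic`
   shared verbatim by the sibling crux chains `Cruxes/HelicalEndLiouville/Ideator{1,3}Sketch` and
   `Cruxes/ForcedSymmetry/Ideator2Sketch`): THE LATTICE IN THE SCREW — the one-parameter group of the Killing
   field `a + Ax` (`A` skew, `a ∉ range A`) contains the nonzero translation `L = (2π/ρ)·P_{ker A} a`
   (`L = a` if `A = 0`), so an annihilated `u` is `L`-periodic.  Pure kinematics.
2. `stub_classCompactness` (M; F3 of the card = the compactness input of support item `LiouvilleKillsTypeI`,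
   stmt-4056, and of every zoom/recentring card of this crux): `A_C` is sequentially compact for locally
   uniform convergence on `(−∞,0) × ℝ³` (class-uniform KNSS Prop. 4.1 bounds `knss2009_local_smoothing_holds` +
   Arzelà–Ascoli + dominated convergence in the Oseen identity, `exists_norm_oseenKernel_le`).
3. `stub_blowdownKillsPeriod` (M–L; LOAD-BEARING; the card's `typeI_constant_tendsto_zero_of_periodic`, takes
   F3 as its antecedent): a periodic element of `A_C` has `√(−t)‖u(t)‖_∞ → 0` as `t → −∞` — zoom OUT at
   near-maximisers (`λ_n = √(−t_n) → ∞`, same `C`, period `L/λ_n → 0`), the F3-limit is invariant under the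
   whole line `ℝL` and nonzero at `(−1, 0)`, contradicting the PROVED tree theorem
   `KNSS2009_typeI_rate_liouville_holds` (bounded shift `w(·−δ)`, direction rotated onto `e₂`).
4. `stub_smallPastLiouville` (M; symmetry-free; the card's `eq_zero_of_typeI_constant_tendsto_zero` = the
   route's "Kato gap" + forward uniqueness): if `√(−t)‖u(t)‖_∞ → 0` at `−∞` then `u ≡ 0` on `t < 0` (ancient
   Oseen identity from `s = −∞`: `N(t) ≤ π³C₀·(sup_{τ≤t} N)²`, `∫_{−∞}^t (t−τ)^{-1/2}(−τ)^{-1}dτ = π/√(−t)`; then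
   `oseenMild_bounded_unique` forward).

Sorry-free compositions: `periodicPastLiouville` (2+3+4: a periodic element of `A_C` vanishes — the merge
group's `PeriodicTypeIAncientLiouville`), `periodicEndLiouville` (END form by the time-shift covariance
`IsTypeIAncientMild.comp_sub_right`), `helicalEndLiouville_of_stubs : HelicalEndLiouville` — the ROUTE ITEM #7
(stmt-14062, hypothesis `hH` of the route's deciding theorem `closes`) BY NAME from stubs 1–4 — and
`helicalTypeILiouville_of_stubs` (exactly the disprover's barrier reduction `Disproof.HelicalTypeILiouville`:
`A ≠ 0`, `a ≠ 0`, `Aa = 0`; `a ∉ range A` is derived from skewness, `not_mem_range_of_skew`).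

The two leaves this line does NOT attack are carried as one stub each so that `SymmetricLiouville_of` concludes
the crux BY NAME (the crux is fixed; its decl quantifies over all of `sim(3)`):

5. `stub_axisymEndLiouville` (L; VERBATIM the route item `AxisymEndLiouville`, stmt-14061, by `Iff.rfl` —
   `stub_axisymEndLiouville_iff`; same name and signature as in line `degenerate-stabiliser-zoom`; own crux
   chain `Cruxes/AxisymEndLiouville` running).
6. `stub_spiralScalingLeaf` (X-strength on its leaf; NOT attacked here): the `σ ≠ 0` leaf normalised to centre
   `0` and rate `1` — bounded-profile (rotated) self-similar Liouville in the gauge class for every skew `A`: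
   `A = 0` is KNOWN (Tsai 1998 Thm 1 `q = ∞` = tree `tsai_selfsimilar_bounded_holds` + the gauge,
   `IsTypeIAncientMild.eq_zero_of_slice_const`; = line `degenerate-stabiliser-zoom`'s `stub_selfSimilarLeaf`),
   `A ≠ 0` is the disprover's `RotatedSelfSimilarLiouville` (Disproof §(b)), decomposed by line
   `degenerate-stabiliser-zoom` into far-field vanishing → Oseen bootstrap → Pineau–Vicol's decaying class,
   where PV 2026 Thm 1.4 (`pineauVicol2026_rss_liouville`) leaves exactly PV Conj. 1.1 = Tsai 2018 Conj. 8.9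
   on a compact window of rotation rates.  By the route's time-anchor collapse (rev 5 `closes`) this leaf is
   OFF the route's critical path; it is here only because the crux decl contains it.

`SymmetricLiouville_of : SymmetricLiouville` does the conjugacy bookkeeping (split `σ = 0` / `a ∈ range A`;
translation to the spiral centre `exists_spiral_centre` + `isTypeIAncientMild_comp_add_right`; `ξ ↦ ξ/σ`).

## Disproof used (`Cruxes/SymmetricLiouville/Disproof.lean` v7 (cycle 2, §§(a)–(f)) + landed `Theorems/SymmetricLiouville/Negative/*`)

`_false_without_typeI` / `_typeI_near_zero_bounded_past`: the Type-I rate AT `−∞` is used by stub 3 (same-`C`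
invariance of the blow-down; the limit is killed by the Type-I translation leaf) and by stub 4 (free term
`e^{(t−s)Δ}u(s) → 0` as `s → −∞`, and smallness of `√(−t)‖u‖` near `−∞`; the constant field is excluded
exactly there).  `_false_without_mild` / `_false_mild_on_window`: the Oseen identity back to `−∞` is used by
stub 2 (mild closure), stub 3 (the tree leaf is a statement about Oseen-mild fields) and stub 4 (ancient Duhamel
representation; the parasitic `(1−t)⁻¹e₀` is translation-invariant, periodic, Type-I, and dies only here).
`_false_on_window` (viscous shear wave `e^{−4π²t} sin(2πy₀) e₁`: translation-invariant, periodic, mild and Type-I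
on every finite window): stubs 3 and 4 are void on windows BY DESIGN — the zoom-out leaves every window and the
gap inequality integrates from `−∞`; the line uses ancientness essentially, as the disprover demands.
`_false_with_bounded`: no stub concludes `u = 0` from boundedness (stub 4's hypothesis is decay of the Type-I
constant, stub 3's output is that decay).  v7 §(d): the GAP THEOREM `exists_eps_small_vanishes` is the engine of stub 4
(run on a backward end via the time shift) and `InClass.vanishes_of_duhamel_zero` / `vanishes_of_heatMild_typeI`
confirm that stubs 3–4 must and do use the nonlinearity only through the Oseen identity of the CLASS (the limit in
stub 3 is a genuine element of `A_C`; stub 4 is perturbative by design and legitimate because stub 3 supplies the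
smallness); v7 §(f): `periodic_of_screw_clause` / `InClass.periodic_of_hasSymmetry_screw` kernel-check stub 1 in
normal form (`A = J`, `a = h e_z`), leaving it the conjugation algebra; v7 §(e) (`IsSkew` shields nothing) is not
used — the stubs keep `IsSkew` as the crux states it.  Negatives index (`ledger negatives`: stmt-4055
`FiniteTangentModuli`, stmt-0154): untouched — no stub is a linearised/tangent count or a Clay non-uniqueness
statement.  `-- Targets`: none recorded in Disproof.lean (no stub kill, no line picked yet).
-/

noncomputable section

set_option linter.dupNamespace false

open Set Function Filter
open scoped Topology InnerProductSpace RealInnerProductSpace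
open Literature.Analysis.FluidPDE
open Summit.NavierStokesRegularity.NavierStokesRegularity.Theses.SymmetryModuliCount

namespace Summit.NavierStokesRegularity.NavierStokesRegularity.Cruxes.SymmetricLiouville.ScrewLatticeBlowdown

/-! ## The helical leaf, cut along the lever (four stubs) -/

/-- **Stub 1 — the lattice in the screw** (card `periodic_of_screw`; S–M; pure kinematics; verbatim the shared
statement `HelicalOrTranslationIsPeriodic` of `Cruxes/HelicalEndLiouville/Ideator{1,3}Sketch.lean`).  If
`u ∈ A_C` is annihilated on a backward end `t < θ` (`θ ≤ 0`) by the Killing generator `(a + Ax)·∇ − A` with `A`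
skew and `a ∉ range A` — a translation (`A = 0`, `a ≠ 0`) or a screw motion of NONZERO pitch — then every slice
`u(t,·)`, `t < θ`, is periodic with one common nonzero period `L`.  Proof plan (TRIAGE-r1-1 S4, machine-checked
numerically S1/S2, j010063 T1): the flow of the complete affine field `X(x) = a + Ax` is
`Φ_s(x) = e^{sA}x + (∫₀ˢ e^{ρA}dρ) a` (closed form with `NormedSpace.exp`, cf. the PROVED tree lemmas
`comotion_hasDerivAt_flow`, `comotion_apply_integral_exp_smul` of
`Theorems/SymmetryModuliCountForcedSymmetryRigidComotionVanishing.lean`); along it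
`d/ds [e^{−sA} u(t, Φ_s x)] = e^{−sA}(∇u·X − Au)(Φ_s x) = 0`, so `u(t, Φ_s x) = e^{sA} u(t, x)`; a nonzero skew `A`
on `ℝ³` has spectrum `{0, ±iρ}` and `A³ = −ρ²A` (Cayley–Hamilton), hence `e^{(2π/ρ)A} = 1` (Rodrigues), and
`Φ_{2π/ρ}` is the translation by `L = (2π/ρ)·P_{ker A} a`, nonzero because `a ∉ range A = (ker A)ᗮ`; for `A = 0`
take `L = a`.  Only differentiability of the slices is used (from `IsTypeIAncientMild.contDiff_slice`).  The
NORMAL-FORM case (`A = J = rotGenL`, `a = h e_z ∈ ker A`) is kernel-checked by the standing disprover — Disproof.lean v7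
§(f) `screw_equivariant`, `periodic_of_screw_clause`, `InClass.periodic_of_hasSymmetry_screw` (to land as
`Negative.ScrewClause`): `w(θ) = u(R_θx + θh e_z) − R_θu(x)` solves `w' = Jw`, `w(0) = 0`, `‖w‖²` constant — so what
remains here is linear algebra: conjugating a general nonzero skew `A` to `ρJ` by a rotation (spectral normal form on
`ℝ³`), moving `a` into `ker A` by a translation of the origin (`a ↦ a + Ac`), and the case `A = 0`. -/
theorem stub_screwLattice :
    ∀ (C : ℝ) (u : ℝ → EuclideanSpace ℝ (Fin 3) → EuclideanSpace ℝ (Fin 3)),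
      IsTypeIAncientMild C u →
      ∀ (a : EuclideanSpace ℝ (Fin 3)) (A : EuclideanSpace ℝ (Fin 3) →L[ℝ] EuclideanSpace ℝ (Fin 3)) (θ : ℝ),
        (∀ x, inner ℝ (A x) x = 0) → a ∉ Set.range A → θ ≤ 0 →
        (∀ t < θ, ∀ x, fderiv ℝ (u t) x (a + A x) - A (u t x) = 0) →
        ∃ L : EuclideanSpace ℝ (Fin 3), L ≠ 0 ∧ ∀ t < θ, ∀ x, u t (x + L) = u t x := by
  sorry

/-- **Stub 2 — sequential compactness and mild closure of `A_C` (F3)** (M; the ONE unproved analytic input of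
every zoom card of this crux, TRIAGE-r1-1 S3 / r1-2 / r1-3, and of support item `LiouvilleKillsTypeI`
stmt-4056).  Every sequence in `A_C` (same `C`) has a subsequence converging locally uniformly on the open slab
`(−∞,0) × ℝ³` to an element of `A_C`.  Proof plan: class-uniform bounds on every compact sub-slab
`[T₁,T₂] × B̄_R`, `T₂ < 0`: `‖u‖ ≤ C/√(−T₂)`, and `‖∇ˣᵏ∂ₜˡ u‖ ≤ c(k,l,C,T₁,T₂)` from the PROVED local smoothing
fact `knss2009_local_smoothing_holds` (uniform `ε(k,l)`, `C(k,l)`; restart from `s = 2T₁` with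
`M = C/√(−T₂)` in `⌈2C²/ε⌉` steps, representatives identified by `exists_local_smooth_representative` /
`oseenMild_bounded_unique`); Arzelà–Ascoli (`BoundedContinuousFunction.arzela_ascoli`) on an exhaustion by
compacts + a diagonal subsequence gives locally uniform convergence of the fields and of all derivatives; the
limit is `C^∞`, divergence free, obeys `‖w‖ ≤ C/√(−t)`, and satisfies the Oseen identity between all `s < t < 0`
by dominated convergence — heat term: Gaussian against `‖u_n(s,·)‖ ≤ C/√(−s)`; Duhamel term:
`‖K(t−τ, x−y)‖ ≤ C₀(t−τ+‖x−y‖²)^{-2}` (`exists_norm_oseenKernel_le`) times `C²/(−τ)`, integrable on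
`(s,t) × ℝ³` since `∫_s^t (t−τ)^{-1/2}(−τ)^{-1}dτ < ∞`.  (The tree's `KNSS2009_typeI_rate_compactness_holds` is the
same argument for KNSS's blow-up sequences.) -/
theorem stub_classCompactness :
    ∀ (C : ℝ) (u : ℕ → ℝ → EuclideanSpace ℝ (Fin 3) → EuclideanSpace ℝ (Fin 3)),
      (∀ n, IsTypeIAncientMild C (u n)) →
      ∃ (w : ℝ → EuclideanSpace ℝ (Fin 3) → EuclideanSpace ℝ (Fin 3)) (φ : ℕ → ℕ),
        StrictMono φ ∧ IsTypeIAncientMild C w ∧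
        TendstoLocallyUniformlyOn (fun n => Function.uncurry (u (φ n))) (Function.uncurry w)
          Filter.atTop (Set.Iio 0 ×ˢ Set.univ) := by
  sorry

/-- **Stub 3 — blow-down kills the period** (M–L; LOAD-BEARING stub of the line; card
`typeI_constant_tendsto_zero_of_periodic`, TRIAGE-r1-1 S1+S3+S5).  GIVEN F3 (stub 2, as the antecedent), an
element of `A_C` which is periodic under one nonzero translation `L` on the whole past has Type-I constant
tending to zero at `−∞`: `sup_x √(−t)‖u(t,x)‖ → 0` as `t → −∞`.  Proof plan: if not, there are `ε > 0`,
`t_n → −∞` and `x_n` with `√(−t_n)‖u(t_n,x_n)‖ > ε`; the zoom-outs `v_n(s,y) = λ_n u(λ_n² s, x_n + λ_n y)`,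
`λ_n = √(−t_n) → ∞`, lie in `A_C` with the SAME `C` (Type-I bound scale-free, `HasTypeITimeDecay.nsRescale`;
translation covariance `isTypeIAncientMild_comp_add_right` below; parabolic covariance of the Oseen identity,
cf. `oseenDuhamel_parabolicRescale`, `oseenKernel_sq_mul_smul`), have `‖v_n(−1,0)‖ > ε`, and are periodic with
period `L/λ_n → 0`.  By F3 a subsequence converges locally uniformly to `w ∈ A_C`; `‖w(−1,0)‖ ≥ ε`, and for every
real `θ`, choosing integers `k_n` with `k_n L/λ_n → θ L/‖L‖`, locally uniform convergence + continuity of `w`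
(`TendstoLocallyUniformlyOn.tendsto_comp`) give `w(t, x + θ L/‖L‖) = w(t, x)`: `w` is invariant under the whole
line `ℝL`.  Rotate `L/‖L‖` onto `e₂` (the class is `O(3)`-covariant: Gaussian radial, Oseen tensor equivariant)
and shift time by `δ = 1/2` (`IsTypeIAncientMild.comp_sub_right`): `W = w(·−½)` is continuous, bounded by
`C√2`, weakly divergence free, Oseen-mild (`heatExtension` rendering, `IsTypeIAncientMild.mild_eq_heatExtension`),
`x₂`-independent, with `√(−t)‖W(t)‖ ≤ C` — so `W ≡ 0` by the PROVED tree theorem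
`KNSS2009_typeI_rate_liouville_holds` (KNSS 2009 Thm 5.1 + Rem. 6.1 + caloric Liouville), i.e. `w = 0` on
`t < −½`, contradicting `w(−1,0) ≠ 0`. -/
theorem stub_blowdownKillsPeriod :
    (∀ (C : ℝ) (u : ℕ → ℝ → EuclideanSpace ℝ (Fin 3) → EuclideanSpace ℝ (Fin 3)),
      (∀ n, IsTypeIAncientMild C (u n)) →
      ∃ (w : ℝ → EuclideanSpace ℝ (Fin 3) → EuclideanSpace ℝ (Fin 3)) (φ : ℕ → ℕ),
        StrictMono φ ∧ IsTypeIAncientMild C w ∧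
        TendstoLocallyUniformlyOn (fun n => Function.uncurry (u (φ n))) (Function.uncurry w)
          Filter.atTop (Set.Iio 0 ×ˢ Set.univ)) →
    ∀ (C : ℝ) (u : ℝ → EuclideanSpace ℝ (Fin 3) → EuclideanSpace ℝ (Fin 3)),
      IsTypeIAncientMild C u →
      ∀ (L : EuclideanSpace ℝ (Fin 3)), L ≠ 0 → (∀ t < 0, ∀ x, u t (x + L) = u t x) →
        ∀ ε > 0, ∃ T < (0 : ℝ), ∀ t < T, ∀ x, Real.sqrt (-t) * ‖u t x‖ ≤ ε := by
  sorry

/-- **Stub 4 — small at `−∞` forces zero (Kato gap from `s = −∞` + forward uniqueness)** (M; symmetry-free;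
card `eq_zero_of_typeI_constant_tendsto_zero`, TRIAGE-r1-1 S2 with the constants checked: `c₃ = π²`, K1/K2).
If `u ∈ A_C` has `sup_x √(−t)‖u(t,x)‖ → 0` as `t → −∞` then `u ≡ 0` on `t < 0`.  Proof plan: let `s → −∞` in the
Oseen identity (`IsTypeIAncientMild.mild_eq`): the free term `e^{(t−s)Δ}u(s)` is bounded by `C/√(−s) → 0` and
the Duhamel integral converges absolutely (`exists_norm_oseenKernel_le`, `‖K(τ,·)‖_{L¹} = C₀π² τ^{-1/2}`), so
`u(t) = −∫_{−∞}^t ∫ K(t−τ,x−y)[u⊗u](τ,y) dy dτ`; with `N(t) := sup_x √(−t)‖u(t,x)‖` and `M(t) := sup_{τ≤t} N(τ)`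
this gives `N(t) ≤ C₀π² M(t)² √(−t) ∫_{−∞}^t (t−τ)^{-1/2}(−τ)^{-1}dτ = π³C₀ M(t)²`, hence `M(T) ≤ π³C₀ M(T)²`; by
hypothesis `M(T) < 1/(π³C₀)` for `T ≪ 0`, so `M(T) = 0`: `u ≡ 0` on `(−∞, T)` (pattern in tree:
`ChaeWolf.exists_eps_typeI_small_eq_zero`).  Forward: on `[T, t′]`, `t′ < 0`, `u` is bounded by `C/√(−t′)`
and solves the Oseen equation from `s = T − 1` with zero datum, as does `0`; uniqueness of bounded Oseen-mild
solutions (`oseenMild_bounded_unique`, KNSS §4 (4.3)–(4.4)) gives `u(t) = 0` a.e., hence everywhere by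
continuity (`IsTypeIAncientMild.continuous_slice`).  STATUS after Disproof.lean v7 §(d): the backward half IS the
disprover's kernel-checked GAP THEOREM `exists_eps_small_vanishes` (absolute `ε₀ > 0`: `sup √(−t)‖u‖ ≤ ε₀` on the
whole past ⇒ `u ≡ 0`; proposed as `Negative.SmallConstantGap`) applied to the backward shift `u(· + T) ∈ A_C`
(`IsTypeIAncientMild.comp_sub_right`; `√(−s)‖u(s+T)‖ ≤ ε₀√(−s)/√(−s−T) ≤ ε₀` for `T ≤ 0`), and the forward half is
the route's support item `BackwardEndVanishing` (stmt-14064); once both land this stub is their ~30-line glue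
(Disproof §(d) remark (iii) says exactly this), until then it is M from the tree tools named above. -/
theorem stub_smallPastLiouville :
    ∀ (C : ℝ) (u : ℝ → EuclideanSpace ℝ (Fin 3) → EuclideanSpace ℝ (Fin 3)),
      IsTypeIAncientMild C u →
      (∀ ε > 0, ∃ T < (0 : ℝ), ∀ t < T, ∀ x, Real.sqrt (-t) * ‖u t x‖ ≤ ε) →
      ∀ t < 0, ∀ x, u t x = 0 := by
  sorry

/-! ## The two leaves this line does not attack (one stub each) -/

/-- **Stub 5 — axisymmetric leaf on a backward end, swirl allowed, any axis** (L; VERBATIM the route item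
`AxisymEndLiouville`, stmt-NavierStokesRegularity-14061 — `stub_axisymEndLiouville_iff` below is `Iff.rfl`; same
name and signature as the stub of line `degenerate-stabiliser-zoom`; the item has its own crux chain
`Cruxes/AxisymEndLiouville/`).  If `u ∈ A_C` is annihilated on `t < θ` (`θ ≤ 0`) by the rotations about the axis
through `c` generated by a nonzero skew `A` (`∇u·A(x − c) − Au = 0`) then `u ≡ 0` on `t < θ`.  Proof plans on
record: (a) recentring far from the axis degenerates the rotation to a translation (`√(−t)‖u‖ → 0` there), the
axis version of the Oseen bootstrap gives `dist(x, axis)·‖u‖ ≤ K(C)` (cards `stabiliser-at-infinity-decay` /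
`farfield-recentring-critical-rate`, no logarithm: TRIAGE-r1-1 S6), and KNSS 2009 Thm 5.3 = PROVED tree theorem
`KNSS2009_liouville_bound_C_over_r_holds` on the bounded shifts `u(·−δ)` concludes (swirl half alternatively
by card `swirl-barrier-past`, `|r u_θ| ≤ 2C²`); (b) the route's: `A_C ⊂ {𝐈 < ∞}` (item `FarPastLedger`),
blow-down at a nonzero point, persistence of singularities, Seregin–Šverák 2009 Thm 3.1 = tree
`AxisymmetricTypeIExclusion_holds`. -/
theorem stub_axisymEndLiouville :
    ∀ (C : ℝ) (u : ℝ → EuclideanSpace ℝ (Fin 3) → EuclideanSpace ℝ (Fin 3)),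
      IsTypeIAncientMild C u →
      ∀ (c : EuclideanSpace ℝ (Fin 3)) (A : EuclideanSpace ℝ (Fin 3) →L[ℝ] EuclideanSpace ℝ (Fin 3)) (θ : ℝ),
        (∀ x, inner ℝ (A x) x = 0) → A ≠ 0 → θ ≤ 0 →
        (∀ t < θ, ∀ x, fderiv ℝ (u t) x (A (x - c)) - A (u t x) = 0) →
        ∀ t < θ, ∀ x, u t x = 0 := by
  sorry

/-- **Stub 6 — the spiral-scaling leaf `σ ≠ 0`, normalised to centre `0` and rate `1`** (X-strength on its
leaf; NOT attacked by this line).  If `u ∈ A_C` is annihilated by `∇u·(x + Ax) + u + 2t ∂_t u − Au` with `A` skew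
(so `u(t,x) = (−t)^{-1/2} e^{−(s/2)A} U(e^{(s/2)A} x/√(−t))`, `s = −log(−t)`, with a smooth BOUNDED profile
`U = u(−1,·)`, `‖U‖ ≤ C`), then `u ≡ 0`.  Status: `A = 0` KNOWN — Tsai 1998 Thm 1 (`q = ∞`) = tree theorem
`tsai_selfsimilar_bounded_holds` makes `U` constant and the gauge kills constant slices
(`IsTypeIAncientMild.eq_zero_of_slice_const`; exactly where `Negative.symmetricLiouville_false_without_mild`
bites: the parasitic `c/√(−t)` solves the symmetry) — this is line `degenerate-stabiliser-zoom`'s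
`stub_selfSimilarLeaf`; `A ≠ 0` is the disprover's `Disproof.RotatedSelfSimilarLiouville` (bounded profile:
OPEN in print at every rate), which line `degenerate-stabiliser-zoom` decomposes as far-field vanishing
(recentring) → Oseen bootstrap `o(1) ⇒ K/|x|` (`HasTypeIDecay`, Pineau–Vicol (1.10)) → PV 2026 Thm 1.4 = tree
named fact `pineauVicol2026_rss_liouville` off the window, leaving Pineau–Vicol Conj. 1.1 = Tsai 2018 Conj. 8.9
on `α₁(K(C)) ≤ |α| ≤ α₂(K(C))`.  The crux implies this stub (`Disproof.symmetricLiouville_implies_rss`), so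
nothing weaker can stand here; by the route's time-anchor collapse it is off the route's critical path (the
rev-5 `closes` consumes only the Killing leaves `HelicalEndLiouville`, `AxisymEndLiouville`). -/
theorem stub_spiralScalingLeaf :
    ∀ (C : ℝ) (u : ℝ → EuclideanSpace ℝ (Fin 3) → EuclideanSpace ℝ (Fin 3)),
      IsTypeIAncientMild C u →
      ∀ (A : EuclideanSpace ℝ (Fin 3) →L[ℝ] EuclideanSpace ℝ (Fin 3)), (∀ x, inner ℝ (A x) x = 0) →
        (∀ t < 0, ∀ x,
          fderiv ℝ (u t) x (x + A x) + u t x + (2 * t) • timeDeriv u t x - A (u t x) = 0) →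
        ∀ t < 0, ∀ x, u t x = 0 := by
  sorry

/-! ## Sorry-free helpers: conjugation by translations, the spiral centre, skew algebra -/

/-- **`A_C` is invariant under space translations** `u ↦ u(·, · + c)` (same constant): smoothness and the
divergence condition are translation covariant (`IsDivFree.comp_add_right`), the heat flow and the Oseen–Duhamel
term commute with translations (tree `heatFlow_comp_add_right`, `oseenDuhamel_comp_add_right`), the Type-I bound
is uniform in `x` (KNSS 2009 §1: the symmetries of the problem; companion of the tree's
`IsTypeIAncientMild.comp_sub_right`). -/
theorem isTypeIAncientMild_comp_add_right {C : ℝ}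
    {u : ℝ → EuclideanSpace ℝ (Fin 3) → EuclideanSpace ℝ (Fin 3)} (h : IsTypeIAncientMild C u)
    (c : EuclideanSpace ℝ (Fin 3)) : IsTypeIAncientMild C (fun t x => u t (x + c)) := by
  refine ⟨?_, fun t ht => (h.isDivFree ht).comp_add_right c, fun s t hst ht x => ?_,
    fun t ht x => h.norm_le ht (x + c)⟩
  · have e : (uncurry fun t x => u t (x + c)) =
        uncurry u ∘ fun p : ℝ × EuclideanSpace ℝ (Fin 3) => (p.1, p.2 + c) := by
      funext p
      rfl
    rw [e]
    refine h.contDiffOn.comp ((contDiff_fst.prodMk (contDiff_snd.add contDiff_const)).contDiffOn) ?_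
    intro p hp
    exact mem_prod.2 ⟨(mem_prod.1 hp).1, mem_univ _⟩
  · show u t (x + c) = heatFlow (fun y => u s (y + c)) (t - s) x -
        oseenDuhamel 1 s (fun τ y => u τ (y + c)) (fun τ y => u τ (y + c)) t x
    rw [heatFlow_comp_add_right, oseenDuhamel_comp_add_right]
    exact h.mild_eq hst ht (x + c)

/-- For `σ ≠ 0` and `A` skew the spiral scaling `ξ = (a, σ, A)` has a centre: `σc + Ac = −a` is solvable
(`⟪(σ + A)v, v⟫ = σ‖v‖²`, so `σ + A` is injective, hence surjective on `ℝ³`). -/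
theorem exists_spiral_centre {σ : ℝ} (hσ : σ ≠ 0)
    {A : EuclideanSpace ℝ (Fin 3) →L[ℝ] EuclideanSpace ℝ (Fin 3)} (hA : ∀ x, inner ℝ (A x) x = 0)
    (a : EuclideanSpace ℝ (Fin 3)) : ∃ c : EuclideanSpace ℝ (Fin 3), σ • c + A c = -a := by
  let M : EuclideanSpace ℝ (Fin 3) →ₗ[ℝ] EuclideanSpace ℝ (Fin 3) :=
    σ • LinearMap.id + (A : EuclideanSpace ℝ (Fin 3) →ₗ[ℝ] EuclideanSpace ℝ (Fin 3))
  have hM : ∀ v, M v = σ • v + A v := fun v => rfl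
  have hinj : Function.Injective M := by
    intro v w hvw
    have h0 : M (v - w) = 0 := by rw [map_sub, hvw, sub_self]
    rw [hM] at h0
    have h1 : inner ℝ (σ • (v - w) + A (v - w)) (v - w) = 0 := by rw [h0, inner_zero_left]
    rw [inner_add_left, hA (v - w), add_zero, real_inner_smul_left, real_inner_self_eq_norm_sq] at h1
    have h2 : ‖v - w‖ ^ 2 = 0 := by
      rcases mul_eq_zero.1 h1 with h | h
      · exact absurd h hσ
      · exact h
    have h3 : v - w = 0 := by
      rw [← norm_eq_zero]
      exact pow_eq_zero_iff two_ne_zero |>.1 h2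
    exact sub_eq_zero.1 h3
  obtain ⟨c, hc⟩ := (LinearMap.injective_iff_surjective.1 hinj) (-a)
  exact ⟨c, by rw [← hM]; exact hc⟩

/-- Skewness `⟪Ax, x⟫ = 0` polarises to `⟪Ax, y⟫ = −⟪Ay, x⟫`. -/
theorem inner_skew_swap {A : EuclideanSpace ℝ (Fin 3) →L[ℝ] EuclideanSpace ℝ (Fin 3)}
    (hA : ∀ x, inner ℝ (A x) x = 0) (x y : EuclideanSpace ℝ (Fin 3)) :
    inner ℝ (A x) y = - inner ℝ (A y) x := by
  have h := hA (x + y)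
  rw [map_add, inner_add_left, inner_add_right, inner_add_right, hA x, hA y, zero_add, add_zero] at h
  have h' : inner ℝ (A y) x = - inner ℝ (A x) y := by linarith
  rw [h']
  ring

/-- For a skew `A`, a NONZERO vector of `ker A` is not in `range A` (`range A ⊥ ker A`): the normal form
`A a = 0`, `a ≠ 0` of a nonzero-pitch screw (the disprover's `HelicalTypeILiouville`) is an instance of the
route item's hypothesis `a ∉ range A`. -/
theorem not_mem_range_of_skew {A : EuclideanSpace ℝ (Fin 3) →L[ℝ] EuclideanSpace ℝ (Fin 3)}
    (hA : ∀ x, inner ℝ (A x) x = 0) {a : EuclideanSpace ℝ (Fin 3)} (ha : A a = 0) (ha0 : a ≠ 0) :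
    a ∉ Set.range A := by
  rintro ⟨c, hc⟩
  apply ha0
  have h1 : inner ℝ a a = 0 := by
    calc inner ℝ a a = inner ℝ (A c) a := by rw [hc]
      _ = - inner ℝ (A a) c := inner_skew_swap hA c a
      _ = 0 := by rw [ha, inner_zero_left, neg_zero]
  exact inner_self_eq_zero.1 h1

/-! ## Compositions (sorry-free over the stubs) -/

/-- **Periodic Type-I ancient Liouville on the whole past** (the merge group's `PeriodicTypeIAncientLiouville`,
"discrete translations are free"): stubs 2 → 3 → 4. -/
theorem periodicPastLiouville {C : ℝ}
    {u : ℝ → EuclideanSpace ℝ (Fin 3) → EuclideanSpace ℝ (Fin 3)} (hu : IsTypeIAncientMild C u)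
    {L : EuclideanSpace ℝ (Fin 3)} (hL : L ≠ 0) (hper : ∀ t < 0, ∀ x, u t (x + L) = u t x) :
    ∀ t < 0, ∀ x, u t x = 0 :=
  stub_smallPastLiouville C u hu (stub_blowdownKillsPeriod stub_classCompactness C u hu L hL hper)

/-- **Periodic Liouville on a backward END** `t < θ`, `θ ≤ 0`: apply the whole-past statement to the backward
shift `u(· + θ) ∈ A_C` (`IsTypeIAncientMild.comp_sub_right`; periodicity is time-independent). -/
theorem periodicEndLiouville {C : ℝ}
    {u : ℝ → EuclideanSpace ℝ (Fin 3) → EuclideanSpace ℝ (Fin 3)} (hu : IsTypeIAncientMild C u)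
    {L : EuclideanSpace ℝ (Fin 3)} (hL : L ≠ 0) {θ : ℝ} (hθ : θ ≤ 0)
    (hper : ∀ t < θ, ∀ x, u t (x + L) = u t x) : ∀ t < θ, ∀ x, u t x = 0 := by
  intro t ht x
  have hv : IsTypeIAncientMild C (fun s => u (s - -θ)) := hu.comp_sub_right (by linarith)
  have hpv : ∀ s < 0, ∀ y, (fun s => u (s - -θ)) s (y + L) = (fun s => u (s - -θ)) s y := by
    intro s hs y
    exact hper (s - -θ) (by linarith) y
  have key := periodicPastLiouville hv hL hpv (t - θ) (by linarith) x
  have e : t - θ - -θ = t := by ring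
  simpa only [e] using key

/-- **The route item `HelicalEndLiouville` (stmt-NavierStokesRegularity-14062, crux r7, hypothesis `hH` of the
route's deciding theorem `closes`) BY NAME from stubs 1–4**: screw ⊃ lattice, then the periodic end-Liouville
theorem. -/
theorem helicalEndLiouville_of_stubs : HelicalEndLiouville := by
  intro C u hu a A θ hA hra hθ hsym
  obtain ⟨L, hL, hper⟩ := stub_screwLattice C u hu a A θ hA hra hθ hsym
  exact periodicEndLiouville hu hL hθ hper

/-- **The disprover's barrier reduction `Disproof.HelicalTypeILiouville`, closed by stubs 1–4** (its shape:
`A ≠ 0` skew, `a ≠ 0`, `A a = 0`, symmetry on the whole past; `a ∉ range A` by `not_mem_range_of_skew`). -/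
theorem helicalTypeILiouville_of_stubs :
    ∀ (C : ℝ) (u : ℝ → EuclideanSpace ℝ (Fin 3) → EuclideanSpace ℝ (Fin 3)),
      IsTypeIAncientMild C u →
      ∀ (a : EuclideanSpace ℝ (Fin 3)) (A : EuclideanSpace ℝ (Fin 3) →L[ℝ] EuclideanSpace ℝ (Fin 3)),
        (∀ x, inner ℝ (A x) x = 0) → A ≠ 0 → a ≠ 0 → A a = 0 →
        (∀ t < 0, ∀ x, fderiv ℝ (u t) x (a + A x) - A (u t x) = 0) →
        ∀ t < 0, ∀ x, u t x = 0 := by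
  intro C u hu a A hA _hA0 ha0 haA hsym
  exact helicalEndLiouville_of_stubs C u hu a A 0 hA (not_mem_range_of_skew hA haA ha0) le_rfl hsym

/-- **The translation leaf as the case `A = 0`** (`a ∉ range 0 = {0}` iff `a ≠ 0`): an element of `A_C` with
`a·∇u ≡ 0` on the past vanishes — through the stubs this is the tree's `KNSS2009_typeI_rate_liouville_holds`
re-derived for abstract `A_C` (unbounded near `t = 0`). -/
theorem translationLeaf_of_stubs :
    ∀ (C : ℝ) (u : ℝ → EuclideanSpace ℝ (Fin 3) → EuclideanSpace ℝ (Fin 3)),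
      IsTypeIAncientMild C u → ∀ (a : EuclideanSpace ℝ (Fin 3)), a ≠ 0 →
        (∀ t < 0, ∀ x, fderiv ℝ (u t) x a = 0) → ∀ t < 0, ∀ x, u t x = 0 := by
  intro C u hu a ha0 hsym
  have hra : a ∉ Set.range (0 : EuclideanSpace ℝ (Fin 3) →L[ℝ] EuclideanSpace ℝ (Fin 3)) := by
    rintro ⟨c, hc⟩
    exact ha0 (by rw [← hc]; simp)
  refine helicalEndLiouville_of_stubs C u hu a 0 0 (fun x => by simp) hra le_rfl ?_
  intro t ht x
  simpa using hsym t ht x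

/-- Stub 5 is the route item `AxisymEndLiouville` (stmt-NavierStokesRegularity-14061), verbatim. -/
theorem stub_axisymEndLiouville_iff :
    (∀ (C : ℝ) (u : ℝ → EuclideanSpace ℝ (Fin 3) → EuclideanSpace ℝ (Fin 3)),
      IsTypeIAncientMild C u →
      ∀ (c : EuclideanSpace ℝ (Fin 3)) (A : EuclideanSpace ℝ (Fin 3) →L[ℝ] EuclideanSpace ℝ (Fin 3)) (θ : ℝ),
        (∀ x, inner ℝ (A x) x = 0) → A ≠ 0 → θ ≤ 0 →
        (∀ t < θ, ∀ x, fderiv ℝ (u t) x (A (x - c)) - A (u t x) = 0) →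
        ∀ t < θ, ∀ x, u t x = 0) ↔ AxisymEndLiouville :=
  Iff.rfl

/-- **The skeleton concludes the crux BY NAME**: `SymmetricLiouville` (route `SymmetryModuliCount`,
stmt-NavierStokesRegularity-4053) from the six stubs.  Conjugacy bookkeeping: `σ = 0` ⇒ Killing generator
`(a, A)`, split on `a ∈ range A` (rotation about the axis through `−c`, `a = Ac`: stub 5 at `θ = 0`) /
`a ∉ range A` (translation or nonzero-pitch screw: stubs 1–4 through `helicalEndLiouville_of_stubs` at
`θ = 0`); `σ ≠ 0` ⇒ translate to the centre `c` of the spiral scaling (`exists_spiral_centre`,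
`isTypeIAncientMild_comp_add_right`), divide the generator by `σ`, stub 6. -/
theorem SymmetricLiouville_of : SymmetricLiouville := by
  intro C u hu a σ A hA hne hL t ht x
  have hcl : IsTypeIAncientMild C u := isTypeIAncientMild_iff.2 hu
  rcases eq_or_ne σ 0 with rfl | hσ
  · -- ISOMETRIC (Killing) leaves: `L_ξ u = ∇u·(a + Ax) − Au`
    have hK : ∀ t < 0, ∀ x, fderiv ℝ (u t) x (a + A x) - A (u t x) = 0 := by
      intro t ht x
      have h1 := hL t ht x
      simp only [zero_smul, add_zero, mul_zero, zero_mul] at h1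
      exact h1
    by_cases hra : a ∈ Set.range A
    · -- rotation about the axis through `-c`: stub 5 at `θ = 0`
      obtain ⟨c, hc⟩ := hra
      have hA0 : A ≠ 0 := by
        rintro rfl
        apply hne
        refine ⟨?_, rfl, rfl⟩
        rw [← hc]
        simp
      refine stub_axisymEndLiouville C u hcl (-c) A 0 hA hA0 le_rfl ?_ t ht x
      intro t ht x
      have e : A (x - -c) = a + A x := by
        rw [sub_neg_eq_add, map_add, hc, add_comm]
      rw [e]
      exact hK t ht x
    · -- translation or screw of nonzero pitch: stubs 1–4 at `θ = 0`
      exact helicalEndLiouville_of_stubs C u hcl a A 0 hA hra le_rfl hK t ht x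
  · -- SPIRAL SCALINGS `σ ≠ 0`: translate to the centre, normalise the rate to `1`, stub 6
    obtain ⟨c, hc⟩ := exists_spiral_centre hσ hA a
    have hv : IsTypeIAncientMild C (fun t x => u t (x + c)) := isTypeIAncientMild_comp_add_right hcl c
    set A' : EuclideanSpace ℝ (Fin 3) →L[ℝ] EuclideanSpace ℝ (Fin 3) := σ⁻¹ • A with hA'def
    have hA' : ∀ x, inner ℝ (A' x) x = 0 := by
      intro x
      rw [hA'def, FunLike.coe_smul, Pi.smul_apply, real_inner_smul_left, hA x, mul_zero]
    -- the normalised symmetry of the translated field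
    have hLv : ∀ t < 0, ∀ x, fderiv ℝ (fun y => u t (y + c)) x (x + A' x) + u t (x + c) +
        (2 * t) • timeDeriv (fun s y => u s (y + c)) t x - A' (u t (x + c)) = 0 := by
      intro t ht x
      have key := hL t ht (x + c)
      have e1 : a + σ • (x + c) + A (x + c) = σ • x + A x := by
        have h0 : σ • c + A c + a = 0 := by rw [hc, neg_add_cancel]
        calc a + σ • (x + c) + A (x + c) = σ • x + A x + (σ • c + A c + a) := by
              rw [smul_add, map_add]; abel
          _ = σ • x + A x := by rw [h0, add_zero]
      rw [e1] at key
      have e2 : fderiv ℝ (fun y => u t (y + c)) x = fderiv ℝ (u t) (x + c) := by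
        rw [fderiv_comp_add_right]
      have e3 : timeDeriv (fun s y => u s (y + c)) t x = timeDeriv u t (x + c) := rfl
      rw [e2, e3]
      have k2 := congrArg (fun w => σ⁻¹ • w) key
      simp only [smul_zero, smul_add, smul_sub, smul_smul, inv_mul_cancel₀ hσ, one_smul] at k2
      have e5 : σ⁻¹ * (2 * σ * t) = 2 * t := by
        field_simp
      have e6 : σ⁻¹ • fderiv ℝ (u t) (x + c) (σ • x + A x) = fderiv ℝ (u t) (x + c) (x + A' x) := by
        rw [← (fderiv ℝ (u t) (x + c)).map_smul]
        congr 1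
        rw [hA'def, FunLike.coe_smul, Pi.smul_apply, smul_add, smul_smul, inv_mul_cancel₀ hσ, one_smul]
      have e7 : σ⁻¹ • A (u t (x + c)) = A' (u t (x + c)) := by
        rw [hA'def, FunLike.coe_smul, Pi.smul_apply]
      rw [e5, e6, e7] at k2
      exact k2
    -- conclude on the translated field by stub 6, then translate back
    have hzero : ∀ t < 0, ∀ x, (fun t x => u t (x + c)) t x = 0 :=
      stub_spiralScalingLeaf C (fun t x => u t (x + c)) hv A' hA' hLv
    have := hzero t ht (x - c)
    simpa only [sub_add_cancel] using this

end Summit.NavierStokesRegularity.NavierStokesRegularity.Cruxes.SymmetricLiouville.ScrewLatticeBlowdown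

end
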